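import Summits.QuantumFields.YangMills.Theorems.BalabanUVNodesPortS1G3CInvariance

/-!
# NODE O port PT-A — `stub_G3C` helper (leaf (α), any edition): THE PARAMETRIX IDENTITY — `A · Σ_□ h_□ G_□ h_□ = 1 + Σ_□ (h_□E_□ + [A, h_□])·G_□·h_□` for multiplication operators
# `h_□` with `Σ_□ h_□² = 1` and local inverses `G_□` (`A·G_□ = Q_□ + E_□·G_□`, `h_□Q_□h_□ = h_□²`), i.e. [B9] (3.87)–(3.88) ∕ (3.95) abstractly: the remainder is driven ONLY by the
# commutators `[A, h_□]` (✓`…G3CCommutator`: `O(1/M)` under (P4-lat)) and the sticking-out parts `h_□E_□` (✓`…G3CStickOut`: `d_j ≥ 1`, small under (P4))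

Cell `ym-nodeO-ideate`, porter hand `hand-27930-G3C` (g0); proof kind, `--supports stmt-QuantumFields-27930 --as helper` (count-neutral).  [B9] = [Balaban1985BackgroundPropagators], [16] = [Balaban1985UV3].

WHY.  Leaf (α) of the walk edition of `Tr (x + T)⁻¹` (`G3C-OBSTRUCTION-v1.md` §5): with `A = x·1 + T`, `T = Σ_Y T_Y`, enlarged cubes `□̃`, X-localized operators `A_□ = x·P_□̃ + T^{(□̃)}`, local inverses
`G_□` (`A_□G_□ = P_□̃`, `P_□̃G_□ = G_□`) and a partition `h_□` supported in `□` with `Σ_□ h_□² = 1`, one has `A·G_□ = P_□̃ + E_□G_□` with `E_□ := A·P_□̃ − A_□` (the pieces sticking out of `□̃`), and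
the identity below gives `A·C₀ = 1 + R`, `C₀ = Σ_□ h_□G_□h_□`, `R = Σ_□ (h_□E_□ + [A,h_□])G_□h_□`; `‖R‖ < 1` (from ✓`…G3CCommutator`, ✓`…G3CStickOut`, ✓`…G3CPieceSum`, ✓`…G3CResolvent`) then yields
`A⁻¹ = C₀·Σ_n (−R)ⁿ` — the generalized random walk expansion ([B9] (3.90)), whose terms are localized in unions of enlarged cubes along the walk.

WHAT THIS FILE PROVES (sorry-free, pure matrix algebra over a finite index type; NO analytic input):
* `diag_mul_diag` ∕ `sum_diag_sq_eq_one` — bookkeeping for the multiplication operators `H_b = diagonal (h_b)` and `Σ_b H_b² = 1`.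
* ★ `parametrix_identity` — `A * Σ_{b∈s} H_b G_b H_b = 1 + Σ_{b∈s} (H_b * E_b + (A * H_b − H_b * A)) * G_b * H_b` under `Σ_b h_b² = 1`, `H_b Q_b H_b = H_b²`, `A G_b = Q_b + E_b G_b`.
* `localInverse_letter` — the hypothesis `A G_b = Q_b + E_b G_b` from the local-inverse letters `A_b * G_b = Q_b`, `Q_b * G_b = G_b`, `E_b = A * Q_b − A_b` (with `Q_b` the coordinate projection `P_□̃`).
* `diag_proj_diag` — `H_b P_S H_b = H_b²` when `supp h_b ⊆ S` (the hypothesis `H_b Q_b H_b = H_b²` for `Q_b = P_S`).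

HONEST FRAMING.  Algebra only; nothing of Bałaban's asserted, ported or discharged; `stub_G3C` NOT closed (mis-cut verdict stands); 27930 OPEN; NODE O 0∕1; COUNT 8∕28 · K 1∕4 UNMOVED; finite `𝕋⁴` at fixed
ε — NOT continuum ∕ OS ∕ Clay; **the Yang–Mills mass gap is NOT proved by any of this.**  No `sorry`, no `instance`, no `notation`, no `def`; standard axioms.
-/

noncomputable section

open scoped BigOperators
open Finset

namespace Summit.QuantumFields.YangMills.Theorems.BalabanUVNodesPortS1.G3CInv

variable {ι : Type*} [Fintype ι] [DecidableEq ι] {β : Type*}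

/-- Product of two multiplication operators. [folklore] -/
theorem diag_mul_diag (f g : ι → ℂ) : Matrix.diagonal f * Matrix.diagonal g = Matrix.diagonal (fun i => f i * g i) :=
  Matrix.diagonal_mul_diagonal f g

/-- `Σ_b H_b² = 1` for a quadratic partition of unity `Σ_b h_b(i)² = 1`. [cite: Balaban1985BackgroundPropagators, (3.87) p.409] -/
theorem sum_diag_sq_eq_one (s : Finset β) (h : β → ι → ℝ) (hsum : ∀ i, ∑ b ∈ s, h b i ^ 2 = 1) :
    ∑ b ∈ s, Matrix.diagonal (fun i => (h b i : ℂ)) * Matrix.diagonal (fun i => (h b i : ℂ)) = (1 : Matrix ι ι ℂ) := by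
  simp_rw [Matrix.diagonal_mul_diagonal]
  ext i j
  rw [Matrix.sum_apply]
  by_cases hij : i = j
  · subst hij
    simp only [Matrix.diagonal_apply_eq, Matrix.one_apply_eq]
    rw [← Complex.ofReal_one, ← hsum i, Complex.ofReal_sum]
    exact Finset.sum_congr rfl fun b _ => by push_cast; ring
  · simp [Matrix.diagonal_apply_ne _ hij, Matrix.one_apply_ne hij]

/-- ★ **THE PARAMETRIX IDENTITY** ([B9] (3.87)–(3.88)∕(3.95), abstract): `A · Σ_b H_b G_b H_b = 1 + Σ_b (H_b E_b + [A, H_b]) G_b H_b`.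
[cite: Balaban1985BackgroundPropagators, (3.87)–(3.88) p.409, (3.95) p.411] -/
theorem parametrix_identity (s : Finset β) (A : Matrix ι ι ℂ) (h : β → ι → ℝ) (G Q E : β → Matrix ι ι ℂ)
    (hsum : ∀ i, ∑ b ∈ s, h b i ^ 2 = 1)
    (hQ : ∀ b ∈ s, Matrix.diagonal (fun i => (h b i : ℂ)) * Q b * Matrix.diagonal (fun i => (h b i : ℂ)) =
      Matrix.diagonal (fun i => (h b i : ℂ)) * Matrix.diagonal (fun i => (h b i : ℂ)))
    (hAG : ∀ b ∈ s, A * G b = Q b + E b * G b) :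
    A * ∑ b ∈ s, Matrix.diagonal (fun i => (h b i : ℂ)) * G b * Matrix.diagonal (fun i => (h b i : ℂ)) =
      1 + ∑ b ∈ s, (Matrix.diagonal (fun i => (h b i : ℂ)) * E b + (A * Matrix.diagonal (fun i => (h b i : ℂ)) - Matrix.diagonal (fun i => (h b i : ℂ)) * A)) *
        G b * Matrix.diagonal (fun i => (h b i : ℂ)) := by
  rw [← sum_diag_sq_eq_one s h hsum, Finset.mul_sum, ← Finset.sum_add_distrib]
  refine Finset.sum_congr rfl fun b hb => ?_
  set H := Matrix.diagonal (fun i => (h b i : ℂ)) with hH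
  -- A H G H = (H A + [A,H]) G H = H (Q + E G) H + [A,H] G H
  have e1 : A * (H * G b * H) = H * (A * G b) * H + (A * H - H * A) * G b * H := by
    simp only [Matrix.sub_mul, Matrix.mul_assoc]; abel
  rw [e1, hAG b hb, Matrix.mul_add, Matrix.add_mul, ← Matrix.mul_assoc, hQ b hb]
  simp only [Matrix.add_mul, Matrix.mul_assoc]
  abel

omit [DecidableEq ι] in
/-- **The local-inverse letters give `A G_b = Q_b + E_b G_b`**: if `A_b * G_b = Q_b`, `Q_b * G_b = G_b` and `E_b = A * Q_b − A_b`, then `A * G_b = Q_b + E_b * G_b`.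
[cite: Balaban1985BackgroundPropagators, (3.88) p.409] -/
theorem localInverse_letter (A Ab G Q E : Matrix ι ι ℂ) (hAbG : Ab * G = Q) (hQG : Q * G = G) (hE : E = A * Q - Ab) :
    A * G = Q + E * G := by
  rw [hE, Matrix.sub_mul, Matrix.mul_assoc, hQG, hAbG]
  abel

/-- **`H P_S H = H²` when `supp h ⊆ S`** (the hypothesis `hQ` of `parametrix_identity` for the coordinate projection `Q = P_S = diagonal 𝟙_S`). [folklore] -/
theorem diag_proj_diag (h : ι → ℝ) (S : ι → Prop) [DecidablePred S] (hsupp : ∀ i, ¬ S i → h i = 0) :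
    Matrix.diagonal (fun i => (h i : ℂ)) * Matrix.diagonal (fun i => if S i then (1 : ℂ) else 0) * Matrix.diagonal (fun i => (h i : ℂ)) =
      Matrix.diagonal (fun i => (h i : ℂ)) * Matrix.diagonal (fun i => (h i : ℂ)) := by
  simp only [Matrix.diagonal_mul_diagonal]
  congr 1
  funext i
  by_cases hi : S i
  · simp [hi]
  · simp [hi, hsupp i hi]

/-! ## Addendum (hand g0): the ONE-SIDED parametrix — sharp partitions, no commutator -/

omit [Fintype ι] in
/-- `Σ_b H_b = 1` for a LINEAR partition of unity `Σ_b h_b(i) = 1` (e.g. the sharp partition `h_□ = 𝟙_□` of the cubes). [cite: Balaban1985BackgroundPropagators, (3.87) p.409] -/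
theorem sum_diag_eq_one (s : Finset β) (h : β → ι → ℝ) (hsum : ∀ i, ∑ b ∈ s, h b i = 1) :
    ∑ b ∈ s, Matrix.diagonal (fun i => (h b i : ℂ)) = (1 : Matrix ι ι ℂ) := by
  ext i j
  rw [Matrix.sum_apply]
  by_cases hij : i = j
  · subst hij
    simp only [Matrix.diagonal_apply_eq, Matrix.one_apply_eq]
    rw [← Complex.ofReal_one, ← hsum i, Complex.ofReal_sum]
  · simp [Matrix.diagonal_apply_ne _ hij, Matrix.one_apply_ne hij]

/-- ★ **THE ONE-SIDED PARAMETRIX IDENTITY**: `A · Σ_b G_b H_b = 1 + Σ_b E_b G_b H_b` under `Σ_b h_b = 1`, `Q_b H_b = H_b` (e.g. `Q_b = P_□̃ ⊇ supp h_b`) and the local-inverse letter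
`A G_b = Q_b + E_b G_b` — NO commutator term: with the SHARP partition `h_□ = 𝟙_□` and `5^d` local blocks the remainder is driven by the sticking-out parts `E_□` alone (the hand's
`G3C-OBSTRUCTION-v1.md` §5b). [cite: Balaban1985BackgroundPropagators, (3.87)–(3.88) p.409, (3.95)–(3.96) p.411] -/
theorem parametrix_identity_oneSided (s : Finset β) (A : Matrix ι ι ℂ) (h : β → ι → ℝ) (G Q E : β → Matrix ι ι ℂ)
    (hsum : ∀ i, ∑ b ∈ s, h b i = 1)
    (hQ : ∀ b ∈ s, Q b * Matrix.diagonal (fun i => (h b i : ℂ)) = Matrix.diagonal (fun i => (h b i : ℂ)))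
    (hAG : ∀ b ∈ s, A * G b = Q b + E b * G b) :
    A * ∑ b ∈ s, G b * Matrix.diagonal (fun i => (h b i : ℂ)) =
      1 + ∑ b ∈ s, E b * G b * Matrix.diagonal (fun i => (h b i : ℂ)) := by
  rw [← sum_diag_eq_one s h hsum, Finset.mul_sum, ← Finset.sum_add_distrib]
  refine Finset.sum_congr rfl fun b hb => ?_
  rw [← Matrix.mul_assoc, hAG b hb, Matrix.add_mul, hQ b hb, Matrix.mul_assoc]

/-- **`P_S H = H` when `supp h ⊆ S`** (the hypothesis `hQ` of `parametrix_identity_oneSided` for the coordinate projection). [folklore] -/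
theorem proj_mul_diag_of_supp (h : ι → ℝ) (S : ι → Prop) [DecidablePred S] (hsupp : ∀ i, ¬ S i → h i = 0) :
    Matrix.diagonal (fun i => if S i then (1 : ℂ) else 0) * Matrix.diagonal (fun i => (h i : ℂ)) = Matrix.diagonal (fun i => (h i : ℂ)) := by
  rw [Matrix.diagonal_mul_diagonal]
  congr 1
  funext i
  by_cases hi : S i
  · simp [hi]
  · simp [hi, hsupp i hi]

end Summit.QuantumFields.YangMills.Theorems.BalabanUVNodesPortS1.G3CInv

end
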